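import Literature.MathematicalPhysics.QuantumLattice.HubbardTTPrimeThermalStatesEntropyDensity
import Literature.MathematicalPhysics.QuantumLattice.HubbardTTPrimeGrandCanonicalThermalStatesMonotone
import HarnessLib

/-!
# The entropy density of thermal grand-canonical states of the 2D `t–t'` Hubbard model is nondecreasing in temperature

Topic `Literature/MathematicalPhysics/QuantumLattice`; a corollary of `HubbardTTPrimeThermalStatesEntropyDensity.lean` (the entropy
density of a thermal grand-canonical state `ω` at `(β; x)`, `x = (t,t',U,μ,h)`, exists and equals `s(ω) = P(β;x) + β·u_x(ω)`,
`…tendsto_vonNeumannEntropy_rdm_div_sq_of_gcGibbs`) and of the thermodynamic stability across states of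
`HubbardTTPrimeGrandCanonicalThermalStatesMonotone.lean` (the `K`-energy is antitone in `β`: `(β₁−β)(u(ω₁)−u(ω)) ≤ 0`) with the joint
temperature tangent plane (`…gcPressureTT'Zeeman_sub_le_sub_mul_energy_of_gcGibbs`: `P(β) − P(β₁) ≤ (β₁ − β)·u(ω)` for `ω` thermal at `β`):

* `IsTorusLimitOfMixture.mul_sub_entropyDensity_sub_nonpos_of_gcGibbs` — for thermal grand-canonical states `ω` at `β` and `ω₁` at `β₁`
  (same couplings, `β, β₁ ≥ 0`): `(β₁ − β)·(s(ω₁) − s(ω)) ≤ 0`, `s(·) = P + β·u(·)` — COOLING LOWERS THE ENTROPY DENSITY (integrated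
  positivity of the specific heat), in particular `s(ω₁) ≤ s(ω)` for `β < β₁` (`…entropyDensity_le_of_gcGibbs`);
* `IsTorusLimitOfMixture.eventually_vonNeumannEntropy_rdm_div_sq_le_of_gcGibbs_of_lt` — the same at the level of the box entropies
  themselves: for `β < β₁` and every `ε > 0`, eventually in `ℓ`, `S(ω₁,[0,ℓ)²)/ℓ² ≤ S(ω,[0,ℓ)²)/ℓ² + ε`.

Everything is PROVED; no definition, no named fact.

## Mathlib / tree search

REUSED: `IsTorusLimitOfMixture.vonNeumannEntropy_rdm_div_sq_mem_Icc_of_gcGibbs`, `IsTranslationInvariant.vonNeumannEntropy_rdm_halfOpenBox_div_sq_le`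
(`HubbardTTPrimeThermalStatesEntropyDensity`); `IsTorusLimitOfMixture.mul_sub_energy_sub_nonpos_of_gcGibbs`
(`HubbardTTPrimeGrandCanonicalThermalStatesMonotone`); `IsTorusLimitOfMixture.gcPressureTT'Zeeman_sub_le_sub_mul_energy_of_gcGibbs`
(`HubbardTTPrimeGrandCanonicalThermalStates`). `lean search 'entropy.*anti.*beta|entropyDensity'`: nothing (2026-08-27).

## References

* R. B. Griffiths, J. Math. Phys. 5 (1964) 1215 (thermodynamic inequalities from convexity). [cite: Griffiths1964]
* R. B. Israel, *Convexity in the Theory of Lattice Gases* (1979), Thm. I.3.4, Lemma II.3.1. [cite: Israel1979, Thm. I.3.4]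
* H. Araki, H. Moriya, Rev. Math. Phys. 15 (2003) 93, Thm. 3.8, §10. [cite: ArakiMoriya2003, Theorem 3.8 and §10]
-/

noncomputable section

open scoped ComplexOrder BigOperators
open Finset Literature.InformationTheory.Entropy

namespace Literature.MathematicalPhysics.QuantumLattice

open Matrix HubbardWave0 Literature.Probability.LatticeModels ThermodynamicLimit
open _root_.Filter
open scoped _root_.Topology

namespace InfVolFermionState

variable {β : ℝ} (hβ : 0 ≤ β) (t t' : ℝ) {U : ℝ} (hU : 0 ≤ U) (μ hz : ℝ)
  {ω ω₁ : InfVolFermionState 2} {Ls Ls₁ : ℕ → ℕ}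
include hβ hU

/-- **Cooling lowers the entropy density.** For thermal grand-canonical states `ω` at `β` and `ω₁` at `β₁` (same `t,t',U,μ,h`;
`β, β₁ ≥ 0`, `U ≥ 0`), with `s(·) = P(β_·) + β_··u(·)` the entropy density of `HubbardTTPrimeThermalStatesEntropyDensity`:
`(β₁ − β)·(s(ω₁) − s(ω)) ≤ 0`. Proof: the tangent plane at the colder state and the antitonicity of the energy give
`s(hot) − s(cold) ≥ β_hot·(u(hot) − u(cold)) ≥ 0`. [cite: Griffiths1964] [cite: Israel1979, Thm. I.3.4] -/
theorem IsTorusLimitOfMixture.mul_sub_entropyDensity_sub_nonpos_of_gcGibbs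
    (hω : ω.IsTorusLimitOfMixture sourcedGibbsCount (gcGibbsWeightTT' β t t' U μ hz) (gcGibbsVectorTT' t t' U μ hz) Ls)
    (hLs : Tendsto Ls atTop atTop) {β₁ : ℝ} (hβ₁ : 0 ≤ β₁)
    (hω₁ : ω₁.IsTorusLimitOfMixture sourcedGibbsCount (gcGibbsWeightTT' β₁ t t' U μ hz) (gcGibbsVectorTT' t t' U μ hz) Ls₁)
    (hLs₁ : Tendsto Ls₁ atTop atTop) :
    (β₁ - β) *
        ((gcPressureTT'Zeeman β₁ t t' U μ hz +
            β₁ * (ω₁.meanEnergy (hubbardTTPrimeFermionInteraction t t' U) 1 - μ * ω₁.density -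
              hz * ((ω₁.expect ({0} : Finset (Site 2)) (nAt 0 (mem_singleton_self 0) 0)).re -
                (ω₁.expect ({0} : Finset (Site 2)) (nAt 0 (mem_singleton_self 0) 1)).re))) -
          (gcPressureTT'Zeeman β t t' U μ hz +
            β * (ω.meanEnergy (hubbardTTPrimeFermionInteraction t t' U) 1 - μ * ω.density -
              hz * ((ω.expect ({0} : Finset (Site 2)) (nAt 0 (mem_singleton_self 0) 0)).re -
                (ω.expect ({0} : Finset (Site 2)) (nAt 0 (mem_singleton_self 0) 1)).re)))) ≤ 0 := by
  set u : ℝ := ω.meanEnergy (hubbardTTPrimeFermionInteraction t t' U) 1 - μ * ω.density -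
    hz * ((ω.expect ({0} : Finset (Site 2)) (nAt 0 (mem_singleton_self 0) 0)).re -
      (ω.expect ({0} : Finset (Site 2)) (nAt 0 (mem_singleton_self 0) 1)).re) with hu
  set u₁ : ℝ := ω₁.meanEnergy (hubbardTTPrimeFermionInteraction t t' U) 1 - μ * ω₁.density -
    hz * ((ω₁.expect ({0} : Finset (Site 2)) (nAt 0 (mem_singleton_self 0) 0)).re -
      (ω₁.expect ({0} : Finset (Site 2)) (nAt 0 (mem_singleton_self 0) 1)).re) with hu₁
  -- tangent planes at both states and the energy antitonicity
  have hT : gcPressureTT'Zeeman β t t' U μ hz - gcPressureTT'Zeeman β₁ t t' U μ hz ≤ (β₁ - β) * u :=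
    hω.gcPressureTT'Zeeman_sub_le_sub_mul_energy_of_gcGibbs hβ t t' hU μ hz hLs hβ₁
  have hT₁ : gcPressureTT'Zeeman β₁ t t' U μ hz - gcPressureTT'Zeeman β t t' U μ hz ≤ (β - β₁) * u₁ :=
    hω₁.gcPressureTT'Zeeman_sub_le_sub_mul_energy_of_gcGibbs hβ₁ t t' hU μ hz hLs₁ hβ
  have hE : (β₁ - β) * (u₁ - u) ≤ 0 := hω.mul_sub_energy_sub_nonpos_of_gcGibbs hβ t t' hU μ hz hLs hβ₁ hω₁ hLs₁
  rcases le_or_gt β β₁ with hle | hlt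
  · -- `ω` is the hotter state: `s(ω) − s(ω₁) ≥ β(u − u₁) ≥ 0`
    have h1 : 0 ≤ β * (β₁ - β) * (u - u₁) := by nlinarith
    nlinarith
  · -- `ω₁` is the hotter state
    have h1 : 0 ≤ β₁ * (β - β₁) * (u₁ - u) := by nlinarith
    nlinarith

/-- **The entropy density of the hotter state is the larger**: for thermal grand-canonical states `ω` at `β` and `ω₁` at `β₁ > β`
(same couplings): `s(ω₁) ≤ s(ω)`. [cite: Griffiths1964] [cite: Israel1979, Thm. I.3.4] -/
theorem IsTorusLimitOfMixture.entropyDensity_le_of_gcGibbs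
    (hω : ω.IsTorusLimitOfMixture sourcedGibbsCount (gcGibbsWeightTT' β t t' U μ hz) (gcGibbsVectorTT' t t' U μ hz) Ls)
    (hLs : Tendsto Ls atTop atTop) {β₁ : ℝ} (hββ₁ : β < β₁)
    (hω₁ : ω₁.IsTorusLimitOfMixture sourcedGibbsCount (gcGibbsWeightTT' β₁ t t' U μ hz) (gcGibbsVectorTT' t t' U μ hz) Ls₁)
    (hLs₁ : Tendsto Ls₁ atTop atTop) :
    gcPressureTT'Zeeman β₁ t t' U μ hz +
        β₁ * (ω₁.meanEnergy (hubbardTTPrimeFermionInteraction t t' U) 1 - μ * ω₁.density -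
          hz * ((ω₁.expect ({0} : Finset (Site 2)) (nAt 0 (mem_singleton_self 0) 0)).re -
            (ω₁.expect ({0} : Finset (Site 2)) (nAt 0 (mem_singleton_self 0) 1)).re)) ≤
      gcPressureTT'Zeeman β t t' U μ hz +
        β * (ω.meanEnergy (hubbardTTPrimeFermionInteraction t t' U) 1 - μ * ω.density -
          hz * ((ω.expect ({0} : Finset (Site 2)) (nAt 0 (mem_singleton_self 0) 0)).re -
            (ω.expect ({0} : Finset (Site 2)) (nAt 0 (mem_singleton_self 0) 1)).re)) := by
  have h := hω.mul_sub_entropyDensity_sub_nonpos_of_gcGibbs hβ t t' hU μ hz hLs (hβ.trans hββ₁.le) hω₁ hLs₁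
  have hpos : 0 < β₁ - β := by linarith
  by_contra hcon
  have hcon' := lt_of_not_ge hcon
  have : 0 < (β₁ - β) * _ := mul_pos hpos (sub_pos.2 hcon')
  linarith

/-- **Box-entropy form**: for thermal grand-canonical states `ω` at `β` and `ω₁` at `β₁ > β` and every `ε > 0`, eventually in `ℓ`,
`S(ω₁,[0,ℓ)²)/ℓ² ≤ S(ω,[0,ℓ)²)/ℓ² + ε`. [cite: ArakiMoriya2003, Theorem 3.8 and §10] -/
theorem IsTorusLimitOfMixture.eventually_vonNeumannEntropy_rdm_div_sq_le_of_gcGibbs_of_lt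
    (hω : ω.IsTorusLimitOfMixture sourcedGibbsCount (gcGibbsWeightTT' β t t' U μ hz) (gcGibbsVectorTT' t t' U μ hz) Ls)
    (hLs : Tendsto Ls atTop atTop) {β₁ : ℝ} (hββ₁ : β < β₁)
    (hω₁ : ω₁.IsTorusLimitOfMixture sourcedGibbsCount (gcGibbsWeightTT' β₁ t t' U μ hz) (gcGibbsVectorTT' t t' U μ hz) Ls₁)
    (hLs₁ : Tendsto Ls₁ atTop atTop) {ε : ℝ} (hε : 0 < ε) :
    ∀ᶠ ℓ : ℕ in atTop, vonNeumannEntropy (ω₁.rdm (halfOpenBox 2 ℓ)) / (ℓ : ℝ) ^ 2 ≤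
      vonNeumannEntropy (ω.rdm (halfOpenBox 2 ℓ)) / (ℓ : ℝ) ^ 2 + ε := by
  have hβ₁ : 0 ≤ β₁ := hβ.trans hββ₁.le
  have hs := hω.entropyDensity_le_of_gcGibbs hβ t t' hU μ hz hLs hββ₁ hω₁ hLs₁
  filter_upwards [(hω₁.isTranslationInvariant).eventually_vonNeumannEntropy_rdm_div_sq_le hβ₁ t t' hU μ hz hε,
    eventually_ge_atTop 1] with ℓ h₁ hℓ
  have h₀ := (hω.vonNeumannEntropy_rdm_div_sq_mem_Icc_of_gcGibbs hβ t t' hU μ hz hLs hℓ).1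
  linarith

end InfVolFermionState

end Literature.MathematicalPhysics.QuantumLattice

end
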